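import Literature.Topology.FourManifolds.BallGluingFoldOut
import Literature.Topology.FourManifolds.CollarUniquenessBall
import Literature.Topology.FourManifolds.CerfGammaFourProofs
import HarnessLib

/-!
# Uniqueness of the gluing of two discs (Hirsch's Theorem 8.2.1 for `𝔻ⁿ⁺¹ ∪_φ 𝔻ⁿ⁺¹`)

Trunk T-4MAN (`Literature/Topology/FourManifolds`). Last of the files discharging, for two closed
discs, the tree's named fact `Literature.Topology.FourManifolds.nonempty_diffeomorph_of_isBoundaryGluing` (`Gluing.lean`):
**two smooth manifolds which are both the gluing `𝔻ⁿ⁺¹ ∪_φ 𝔻ⁿ⁺¹` of two closed discs along the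
same diffeomorphism `φ` of `𝕊ⁿ` are diffeomorphic** (`Literature.Topology.FourManifolds.nonempty_diffeomorph_of_isTwistedSphere`,
Hausdorff gluings; Hirsch (1976), Ch. 8, Thm. 2.1 with Thm. 1.9). Consequences:

* `Literature.Topology.FourManifolds.TwistedSphere.nonempty_diffeomorph'`: any two twisted spheres `Σ(φ)` are diffeomorphic,
  unconditionally (the tree's `TwistedSphere.nonempty_diffeomorph` takes the gluing fact as a
  hypothesis);
* `Literature.Topology.FourManifolds.nonempty_diffeomorph_of_isBoundaryGluing_closedBall`: the named fact
  `nonempty_diffeomorph_of_isBoundaryGluing` holds for `M = N = 𝔻ⁿ⁺¹` and Hausdorff `P`, `P'`;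
* `Literature.Topology.FourManifolds.cerf_twistedSphere_four_of_pi0Diff'`: **Cerf's `Γ₄ = 0` in twisted-sphere form
  (`Literature.Topology.FourManifolds.cerf_twistedSphere_four`, `CerfGammaFour.lean`) follows from Cerf's Théorème 1 alone**
  (`Literature.Topology.FourManifolds.cerf_pi0Diff_sphere_three`, `π₀ Diff(S³)` has the two classes of `id` and a reflection):
  the gluing-uniqueness hypothesis `hU` of `cerf_twistedSphere_four_of_pi0Diff`
  (`RadialExtension.lean`) is discharged.

## The proof

Let `G`, `G'` be gluing data for `P`, `P'` (`BallGluingCharts.lean`). The bicollars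
`G.fold : G.foldNbhd ≅ biShell ε` of the seams (`BallGluingFoldOut.lean`) give **inner collars of
`∂𝔻ⁿ⁺¹` in the two discs** in the sense of `CollarUniquenessBall.lean`:
`G.collarA x = jA⁻¹ (fold⁻¹ x)` on `{1 - ε < ‖x‖ ≤ 1}` and, through the *twist*
`y ↦ (2 - ‖y‖) φ⁻¹(y/‖y‖)` exchanging the inner shell of the second disc with the outer shell of
the fold-out coordinates, `G.collarB y = jB⁻¹ (fold⁻¹ (twist y))`
(`exists_isInnerCollar_collarA/B`). By uniqueness of collars of `∂𝔻`
(`IsInnerCollar.exists_openPartialHomeomorph_conj`) there are diffeomorphisms `GA`, `GB` of the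
open unit ball with `GA ∘ G.collarA = G'.collarA` and `GB ∘ G.collarB = G'.collarB` near the sphere
(`ConjData`). The diffeomorphism `P ≅ P'` is then (`ConjData.glue`)
`jA a ↦ jA' (GA a)` on the interior of the first disc, `jB b ↦ jB' (GB b)` on the interior of the
second disc and `fold'⁻¹ ∘ fold` near the seam; the three formulas agree on overlaps
(`glue_eq_foldInv_fold`), so the map is `C^∞`, and the same construction for the inverted data
is its inverse (`ConjData.diffeomorph`). This is Hirsch's proof of Thm. 8.1.9 / 8.2.1 with the
isotopy-extension step replaced by the elementary `CollarUniquenessBall.lean`.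

## References

* M. W. Hirsch, *Differential Topology*, GTM 33, Springer (1976), Ch. 8, Thm. 1.9 and Thm. 2.1.
* J. Cerf, *Sur les difféomorphismes de la sphère de dimension trois (Γ₄ = 0)*, LNM 53 (1968),
  Ch. I §1, Théorème 1 and Corollaire 1; summary by N. H. Kuiper (front matter).
* J. Milnor, *Lectures on the h-cobordism theorem*, Princeton (1965), §9.
-/

open scoped Manifold ContDiff Topology
open Set Function Metric Filter

noncomputable section

namespace Literature.Topology.FourManifolds

attribute [local instance] fact_finrank_euclideanSpace_succ

/-- Local notation for the model space `ℝⁿ`. -/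
local notation "𝔼 " n:arg => EuclideanSpace ℝ (Fin n)
/-- Local notation for the unit sphere `𝕊ⁿ ⊆ ℝⁿ⁺¹`. -/
local notation "𝕊 " n:arg => (Metric.sphere (0 : EuclideanSpace ℝ (Fin (n + 1))) 1)
/-- Local notation for the closed unit ball `𝔻ⁿ ⊆ ℝⁿ`. -/
local notation "𝔻 " n:arg => (Metric.closedBall (0 : EuclideanSpace ℝ (Fin n)) 1)

/-! ### Shells of the closed disc near its boundary -/

section DiscShell

variable {n : ℕ}

/-- **An open subset of the disc containing the boundary sphere contains a whole shell**
`{1 - ε < ‖a‖}` (compactness of the disc). [folklore] -/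
theorem exists_shell_subset_of_isOpen {U : Set (𝔻 (n + 1))} (hU : IsOpen U)
    (hS : ∀ a : 𝔻 (n + 1), ‖(a : 𝔼 (n + 1))‖ = 1 → a ∈ U) :
    ∃ ε : ℝ, 0 < ε ∧ ∀ a : 𝔻 (n + 1), 1 - ε < ‖(a : 𝔼 (n + 1))‖ → a ∈ U := by
  haveI : CompactSpace (𝔻 (n + 1)) := isCompact_iff_compactSpace.1 (isCompact_closedBall _ _)
  have hK : IsCompact Uᶜ := hU.isClosed_compl.isCompact
  by_cases hne : (Uᶜ : Set (𝔻 (n + 1))).Nonempty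
  · obtain ⟨a₀, ha₀, hmax⟩ := hK.exists_isMaxOn hne (continuous_subtype_val.norm).continuousOn
    have h1 : ‖(a₀ : 𝔼 (n + 1))‖ < 1 :=
      lt_of_le_of_ne (mem_closedBall_zero_iff.1 a₀.2) fun h => ha₀ (hS a₀ h)
    refine ⟨1 - ‖(a₀ : 𝔼 (n + 1))‖, by linarith, fun a ha => ?_⟩
    by_contra haU
    have hle : ‖(a : 𝔼 (n + 1))‖ ≤ ‖(a₀ : 𝔼 (n + 1))‖ := hmax haU
    linarith
  · refine ⟨1, one_pos, fun a _ => ?_⟩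
    by_contra haU
    exact hne ⟨a, haU⟩

/-- The closed ball retraction is `C^∞` (into the disc with its manifold-with-boundary structure)
at interior points of the ball, where it is the identity. [folklore] -/
theorem contMDiffAt_closedBallRetraction {y : 𝔼 (n + 1)} (hy : ‖y‖ < 1) :
    ContMDiffAt 𝓘(ℝ, 𝔼 (n + 1)) (𝓡∂ (n + 1)) ∞ (closedBallRetraction (n + 1)) y :=
  (contMDiffWithinAt_closedBallRetraction hy.le).contMDiffAt
    (Filter.mem_of_superset (isOpen_ball.mem_nhds (mem_ball_zero_iff.2 hy)) ball_subset_closedBall)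

end DiscShell

/-! ### The twist exchanging inner and outer shells -/

section Twist

variable {n : ℕ} (φ : (𝕊 n) ≃ₘ⟮𝓡 n, 𝓡 n⟯ (𝕊 n))

/-- **The twist** `y ↦ (2 - ‖y‖) • φ⁻¹ (y / ‖y‖)`: it exchanges the inner shell `{1 - ε < ‖y‖ ≤ 1}`
of the second disc with the outer shell `{1 ≤ ‖x‖ < 1 + ε}` of the fold-out coordinates, and on
the unit sphere it is `φ⁻¹` (the second-disc label `w` of the seam point `jB w = jA (φ⁻¹ w)` goes
to its fold-out coordinate `φ⁻¹ w`). [folklore] -/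
def twistVec (y : 𝔼 (n + 1)) : 𝔼 (n + 1) :=
  (2 - ‖y‖) • ((φ.symm (radialProjection (sphereBasePoint n) y) : 𝕊 n) : 𝔼 (n + 1))

/-- **The untwist** `x ↦ (2 - ‖x‖) • φ (x / ‖x‖)`, inverse to the twist on `{0 < ‖·‖ < 2}`.
[folklore] -/
def untwistVec (x : 𝔼 (n + 1)) : 𝔼 (n + 1) :=
  (2 - ‖x‖) • ((φ (radialProjection (sphereBasePoint n) x) : 𝕊 n) : 𝔼 (n + 1))

variable {φ}

/-- Norm of the twist. [folklore] -/
theorem norm_twistVec {y : 𝔼 (n + 1)} (hy : ‖y‖ ≤ 2) : ‖twistVec φ y‖ = 2 - ‖y‖ := by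
  rw [twistVec, norm_smul, norm_eq_of_mem_sphere, mul_one, Real.norm_eq_abs, abs_of_nonneg]
  linarith

/-- Norm of the untwist. [folklore] -/
theorem norm_untwistVec {x : 𝔼 (n + 1)} (hx : ‖x‖ ≤ 2) : ‖untwistVec φ x‖ = 2 - ‖x‖ := by
  rw [untwistVec, norm_smul, norm_eq_of_mem_sphere, mul_one, Real.norm_eq_abs, abs_of_nonneg]
  linarith

/-- On the unit sphere the twist is `φ⁻¹`. [folklore] -/
theorem twistVec_coe_sphere (w : 𝕊 n) : twistVec φ (w : 𝔼 (n + 1)) = (φ.symm w : 𝔼 (n + 1)) := by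
  rw [twistVec, radialProjection_coe_sphere, norm_eq_of_mem_sphere]
  norm_num

/-- On the unit sphere the untwist is `φ`. [folklore] -/
theorem untwistVec_coe_sphere (w : 𝕊 n) : untwistVec φ (w : 𝔼 (n + 1)) = (φ w : 𝔼 (n + 1)) := by
  rw [untwistVec, radialProjection_coe_sphere, norm_eq_of_mem_sphere]
  norm_num

/-- The untwist inverts the twist on `{‖y‖ < 2}`. [folklore] -/
theorem untwistVec_twistVec {y : 𝔼 (n + 1)} (hy : ‖y‖ < 2) :
    untwistVec φ (twistVec φ y) = y := by
  have h2 : 0 < 2 - ‖y‖ := by linarith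
  rw [untwistVec, norm_twistVec hy.le, twistVec, radialProjection_smul _ h2,
    Diffeomorph.apply_symm_apply, sub_sub_cancel, norm_smul_coe_radialProjection]

/-- The twist inverts the untwist on `{‖x‖ < 2}`. [folklore] -/
theorem twistVec_untwistVec {x : 𝔼 (n + 1)} (hx : ‖x‖ < 2) :
    twistVec φ (untwistVec φ x) = x := by
  have h2 : 0 < 2 - ‖x‖ := by linarith
  rw [twistVec, norm_untwistVec hx.le, untwistVec, radialProjection_smul _ h2,
    Diffeomorph.symm_apply_apply, sub_sub_cancel, norm_smul_coe_radialProjection]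

/-- The twist is `C^∞` away from the origin. [folklore] -/
theorem contDiffAt_twistVec {y : 𝔼 (n + 1)} (hy : y ≠ 0) : ContDiffAt ℝ ∞ (twistVec φ) y := by
  have h1 : ContMDiffAt 𝓘(ℝ, 𝔼 (n + 1)) 𝓘(ℝ, 𝔼 (n + 1)) ∞
      (fun y => ((φ.symm (radialProjection (sphereBasePoint n) y) : 𝕊 n) : 𝔼 (n + 1))) y :=
    (contMDiff_coe_sphere (E := 𝔼 (n + 1)) (n := n)).contMDiffAt.comp y
      (φ.symm.contMDiff.contMDiffAt.comp y (contMDiffAt_radialProjection _ hy))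
  exact ((contDiffAt_const (c := (2 : ℝ))).sub (contDiffAt_norm ℝ hy)).smul
    (contMDiffAt_iff_contDiffAt.1 h1)

/-- The untwist is `C^∞` away from the origin. [folklore] -/
theorem contDiffAt_untwistVec {x : 𝔼 (n + 1)} (hx : x ≠ 0) : ContDiffAt ℝ ∞ (untwistVec φ) x := by
  have h1 : ContMDiffAt 𝓘(ℝ, 𝔼 (n + 1)) 𝓘(ℝ, 𝔼 (n + 1)) ∞
      (fun x => ((φ (radialProjection (sphereBasePoint n) x) : 𝕊 n) : 𝔼 (n + 1))) x :=
    (contMDiff_coe_sphere (E := 𝔼 (n + 1)) (n := n)).contMDiffAt.comp x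
      (φ.contMDiff.contMDiffAt.comp x (contMDiffAt_radialProjection _ hx))
  exact ((contDiffAt_const (c := (2 : ℝ))).sub (contDiffAt_norm ℝ hx)).smul
    (contMDiffAt_iff_contDiffAt.1 h1)

end Twist

/-! ### Inner collars of the two discs from the bicollar of the seam -/

section Collars

variable {n : ℕ} {φ : (𝕊 n) ≃ₘ⟮𝓡 n, 𝓡 n⟯ (𝕊 n)} {P : Type*} [TopologicalSpace P]
  [ChartedSpace (𝔼 (n + 1)) P] [IsManifold (𝓡 (n + 1)) ∞ P] [T2Space P]

namespace BallGluingData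

variable (G : BallGluingData n φ P)

/-- **The inner collar of `∂𝔻` in the first disc induced by the bicollar**: `x ↦ jA⁻¹ (fold⁻¹ x)`
(as a vector of `ℝⁿ⁺¹`). [folklore] -/
def collarA (x : 𝔼 (n + 1)) : 𝔼 (n + 1) := ((G.invA (G.foldInv x) : 𝔻 (n + 1)) : 𝔼 (n + 1))

/-- Its inverse `y ↦ fold (jA y)`. [folklore] -/
def collarAInv (y : 𝔼 (n + 1)) : 𝔼 (n + 1) := G.fold (G.jA (closedBallRetraction (n + 1) y))

/-- **The inner collar of `∂𝔻` in the second disc induced by the bicollar**: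
`y ↦ jB⁻¹ (fold⁻¹ (twist y))`. [folklore] -/
def collarB (y : 𝔼 (n + 1)) : 𝔼 (n + 1) :=
  ((G.invB (G.foldInv (twistVec φ y)) : 𝔻 (n + 1)) : 𝔼 (n + 1))

/-- Its inverse `x ↦ untwist (fold (jB x))`. [folklore] -/
def collarBInv (x : 𝔼 (n + 1)) : 𝔼 (n + 1) :=
  untwistVec φ (G.fold (G.jB (closedBallRetraction (n + 1) x)))

omit [T2Space P] in
/-- `jA⁻¹` is `C^∞` (as a vector of `ℝⁿ⁺¹`) at points having a neighbourhood inside the first disc.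
[folklore] -/
theorem contMDiffAt_coe_invA {U : Set P} (hU : IsOpen U) (hUA : U ⊆ range G.jA) {p : P}
    (hp : p ∈ U) :
    ContMDiffAt (𝓡 (n + 1)) 𝓘(ℝ, 𝔼 (n + 1)) ∞
      (fun q => ((G.invA q : 𝔻 (n + 1)) : 𝔼 (n + 1))) p := by
  set c := chartAt (𝔼 (n + 1)) p
  have hc : c ∈ IsManifold.maximalAtlas (𝓡 (n + 1)) ∞ P := IsManifold.chart_mem_maximalAtlas p
  have hpc : p ∈ c.source := mem_chart_source _ p
  have hS : IsOpen (c '' (U ∩ c.source)) :=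
    c.isOpen_image_of_subset_source (hU.inter c.open_source) inter_subset_right
  have h1 : ContDiffOn ℝ ∞ (fun u => ((G.invA (c.symm u) : 𝔻 (n + 1)) : 𝔼 (n + 1)))
      (c '' (U ∩ c.source)) :=
    (contDiffOn_coe_ballEmbeddingInv_symm G.isSmoothEmbedding_jA hc).mono
      (image_mono (inter_subset_inter_left _ hUA))
  have h2 : ContMDiffAt 𝓘(ℝ, 𝔼 (n + 1)) 𝓘(ℝ, 𝔼 (n + 1)) ∞
      (fun u => ((G.invA (c.symm u) : 𝔻 (n + 1)) : 𝔼 (n + 1))) (c p) :=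
    (h1.contDiffAt (hS.mem_nhds ⟨p, ⟨hp, hpc⟩, rfl⟩)).contMDiffAt
  have h3 := h2.comp p (contMDiffAt_of_mem_maximalAtlas hc hpc)
  refine h3.congr_of_eventuallyEq ?_
  filter_upwards [c.open_source.mem_nhds hpc] with q hq
  simp only [comp_apply, c.left_inv hq]

omit [T2Space P] in
/-- `jB⁻¹` is `C^∞` at points having a neighbourhood inside the second disc. [folklore] -/
theorem contMDiffAt_coe_invB {U : Set P} (hU : IsOpen U) (hUB : U ⊆ range G.jB) {p : P}
    (hp : p ∈ U) :
    ContMDiffAt (𝓡 (n + 1)) 𝓘(ℝ, 𝔼 (n + 1)) ∞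
      (fun q => ((G.invB q : 𝔻 (n + 1)) : 𝔼 (n + 1))) p :=
  G.symm.contMDiffAt_coe_invA hU hUB hp

/-- `jA⁻¹ ∘ fold⁻¹` is `C^∞` on the inner half `{‖x‖ ≤ 1}` of the shell (one-sided derivatives on
the sphere). [folklore] -/
theorem contDiffOn_collarA :
    ContDiffOn ℝ ∞ G.collarA (closedBall (0 : 𝔼 (n + 1)) 1 ∩ biShell G.foldRadius) := by
  apply contDiffOn_of_locally_contDiffOn
  rintro x ⟨hx1, hx⟩
  set p := G.foldInv x
  set c := chartAt (𝔼 (n + 1)) p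
  have hc : c ∈ IsManifold.maximalAtlas (𝓡 (n + 1)) ∞ P := IsManifold.chart_mem_maximalAtlas p
  have hpc : p ∈ c.source := mem_chart_source _ p
  set W := biShell G.foldRadius ∩ G.foldInv ⁻¹' c.source with hW
  have hWo : IsOpen W :=
    G.continuousOn_foldInv.isOpen_inter_preimage (isOpen_biShell _) c.open_source
  refine ⟨W, hWo, ⟨hx, hpc⟩, ?_⟩
  -- on `closedBall ∩ W`, `collarA = (jA⁻¹ ∘ c⁻¹) ∘ (c ∘ foldInv)`
  have h1 : ContMDiffOn 𝓘(ℝ, 𝔼 (n + 1)) 𝓘(ℝ, 𝔼 (n + 1)) ∞ (c ∘ G.foldInv) W :=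
    (contMDiffOn_of_mem_maximalAtlas hc).comp (G.contMDiffOn_foldInv.mono inter_subset_left)
      fun y hy => hy.2
  have h2 : ContDiffOn ℝ ∞ (c ∘ G.foldInv) W := contMDiffOn_iff_contDiffOn.1 h1
  have h3 := contDiffOn_coe_ballEmbeddingInv_symm G.isSmoothEmbedding_jA hc
  have h4 : MapsTo (c ∘ G.foldInv) (closedBall (0 : 𝔼 (n + 1)) 1 ∩ W)
      (c '' (range G.jA ∩ c.source)) := by
    rintro y ⟨hy1, hy, hyc⟩
    exact ⟨G.foldInv y, ⟨G.foldInv_mem_range_jA hy (mem_closedBall_zero_iff.1 hy1), hyc⟩, rfl⟩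
  have h5 := h3.comp (h2.mono inter_subset_right) h4
  refine (h5.congr ?_).mono ?_
  · rintro y ⟨-, -, hyc⟩
    simp only [collarA, invA, comp_apply, c.left_inv hyc]
  · rintro y ⟨⟨hy1, hy⟩, hyW⟩
    exact ⟨hy1, hyW⟩

/-- `jB⁻¹ ∘ fold⁻¹` is `C^∞` on the outer half `{1 ≤ ‖x‖}` of the shell. [folklore] -/
theorem contDiffOn_invB_foldInv :
    ContDiffOn ℝ ∞ (fun x => ((G.invB (G.foldInv x) : 𝔻 (n + 1)) : 𝔼 (n + 1)))
      ({x : 𝔼 (n + 1) | 1 ≤ ‖x‖} ∩ biShell G.foldRadius) := by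
  apply contDiffOn_of_locally_contDiffOn
  rintro x ⟨hx1, hx⟩
  set p := G.foldInv x
  set c := chartAt (𝔼 (n + 1)) p
  have hc : c ∈ IsManifold.maximalAtlas (𝓡 (n + 1)) ∞ P := IsManifold.chart_mem_maximalAtlas p
  have hpc : p ∈ c.source := mem_chart_source _ p
  set W := biShell G.foldRadius ∩ G.foldInv ⁻¹' c.source with hW
  have hWo : IsOpen W :=
    G.continuousOn_foldInv.isOpen_inter_preimage (isOpen_biShell _) c.open_source
  refine ⟨W, hWo, ⟨hx, hpc⟩, ?_⟩
  have h1 : ContMDiffOn 𝓘(ℝ, 𝔼 (n + 1)) 𝓘(ℝ, 𝔼 (n + 1)) ∞ (c ∘ G.foldInv) W :=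
    (contMDiffOn_of_mem_maximalAtlas hc).comp (G.contMDiffOn_foldInv.mono inter_subset_left)
      fun y hy => hy.2
  have h2 : ContDiffOn ℝ ∞ (c ∘ G.foldInv) W := contMDiffOn_iff_contDiffOn.1 h1
  have h3 := contDiffOn_coe_ballEmbeddingInv_symm G.isSmoothEmbedding_jB hc
  have h4 : MapsTo (c ∘ G.foldInv) ({x : 𝔼 (n + 1) | 1 ≤ ‖x‖} ∩ W)
      (c '' (range G.jB ∩ c.source)) := by
    rintro y ⟨hy1, hy, hyc⟩
    exact ⟨G.foldInv y, ⟨G.foldInv_mem_range_jB hy hy1, hyc⟩, rfl⟩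
  have h5 := h3.comp (h2.mono inter_subset_right) h4
  refine (h5.congr ?_).mono ?_
  · rintro y ⟨-, -, hyc⟩
    simp only [invB, comp_apply, c.left_inv hyc]
  · rintro y ⟨⟨hy1, hy⟩, hyW⟩
    exact ⟨hy1, hyW⟩

/-- The twist maps the inner half shell to the outer half shell. [folklore] -/
theorem twistVec_mem {y : 𝔼 (n + 1)} (hy1 : ‖y‖ ≤ 1)
    (hy : y ∈ (biShell G.foldRadius : Set (𝔼 (n + 1)))) :
    twistVec φ y ∈ {x : 𝔼 (n + 1) | 1 ≤ ‖x‖} ∩ biShell G.foldRadius := by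
  have h := norm_twistVec (φ := φ) (by linarith : ‖y‖ ≤ 2)
  refine ⟨?_, ?_, ?_⟩
  · change 1 ≤ ‖twistVec φ y‖; rw [h]; linarith
  · rw [h]; linarith [hy.2, G.foldRadius_pos]
  · rw [h]; linarith [hy.1]

/-- `jB⁻¹ ∘ fold⁻¹ ∘ twist` is `C^∞` on the inner half shell. [folklore] -/
theorem contDiffOn_collarB :
    ContDiffOn ℝ ∞ G.collarB (closedBall (0 : 𝔼 (n + 1)) 1 ∩ biShell G.foldRadius) := by
  refine G.contDiffOn_invB_foldInv.comp ?_ ?_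
  · rintro y ⟨hy1, hy⟩
    have hy0 : y ≠ 0 := ne_zero_of_mem_biShell G.foldRadius_le_one hy
    exact (contDiffAt_twistVec hy0).contDiffWithinAt
  · rintro y ⟨hy1, hy⟩
    exact G.twistVec_mem (mem_closedBall_zero_iff.1 hy1) hy

/-- Width for the first disc: beyond it, `jA` lands in the bicollar neighbourhood. [folklore] -/
theorem exists_width_jA : ∃ ε : ℝ, 0 < ε ∧
    ∀ a : 𝔻 (n + 1), 1 - ε < ‖(a : 𝔼 (n + 1))‖ → G.jA a ∈ G.foldNbhd := by
  refine exists_shell_subset_of_isOpen (G.isOpen_foldNbhd.preimage G.continuous_jA) fun a ha => ?_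
  obtain ⟨z, rfl⟩ := exists_sphereToBall_eq ha
  change G.jA (sphereToBall n z) ∈ G.foldNbhd
  exact G.jA_sphereToBall_mem_foldNbhd z

/-- Width for the second disc: beyond it, `jB` lands in the bicollar neighbourhood. [folklore] -/
theorem exists_width_jB : ∃ ε : ℝ, 0 < ε ∧
    ∀ b : 𝔻 (n + 1), 1 - ε < ‖(b : 𝔼 (n + 1))‖ → G.jB b ∈ G.foldNbhd := by
  refine exists_shell_subset_of_isOpen (G.isOpen_foldNbhd.preimage G.continuous_jB) fun b hb => ?_
  obtain ⟨w, rfl⟩ := exists_sphereToBall_eq hb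
  change G.jB (sphereToBall n w) ∈ G.foldNbhd
  rw [G.jB_sphereToBall]
  exact G.jA_sphereToBall_mem_foldNbhd _

/-- A closed shell of width `≤ foldRadius` lies in the inner half of the bicollar shell.
[folklore] -/
theorem closedShell_subset {ε : ℝ} (hε : ε ≤ G.foldRadius) :
    (closedShell ε : Set (𝔼 (n + 1))) ⊆ closedBall (0 : 𝔼 (n + 1)) 1 ∩ biShell G.foldRadius := by
  intro x hx
  rw [mem_closedShell_iff] at hx
  exact ⟨mem_closedBall_zero_iff.2 hx.2, by linarith [hx.1], by linarith [hx.2, G.foldRadius_pos]⟩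

/-- **The bicollar induces an inner collar of `∂𝔻` in the first disc.** [folklore] -/
theorem exists_isInnerCollar_collarA :
    ∃ ε : ℝ, ε ≤ G.foldRadius ∧ IsInnerCollar ε G.collarA G.collarAInv := by
  obtain ⟨ε₁, hε₁, hw⟩ := G.exists_width_jA
  refine ⟨min ε₁ G.foldRadius, min_le_right _ _, ?_⟩
  have hsub := G.closedShell_subset (min_le_right ε₁ G.foldRadius)
  refine { pos := lt_min hε₁ G.foldRadius_pos
           contDiffOn := G.contDiffOn_collarA.mono hsub
           contDiffOn_symm := ?_
           eq_self := ?_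
           norm_le_one := ?_
           norm_lt_one := ?_
           left_inv := ?_ }
  · intro x hx
    have hx' := mem_closedShell_iff.1 hx
    set a : 𝔻 (n + 1) := closedBallRetraction (n + 1) x with ha
    have hax : (a : 𝔼 (n + 1)) = x := closedBallRetraction_of_norm_le (n + 1) hx'.2
    have haN : G.jA a ∈ G.foldNbhd := hw a (by
      rw [hax]; exact lt_of_le_of_lt (by linarith [min_le_left ε₁ G.foldRadius]) hx'.1)
    have hg : ContMDiffAt (𝓡∂ (n + 1)) 𝓘(ℝ, 𝔼 (n + 1)) ∞ (fun y : 𝔻 (n + 1) => G.fold (G.jA y)) a :=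
      (G.contMDiffAt_fold_of_mem haN).comp a G.contMDiff_jA.contMDiffAt
    have h := contDiffWithinAt_comp_closedBallRetraction hg
    rw [hax] at h
    exact h.mono closedShell_subset_closedBall
  · intro x hx
    set z : 𝕊 n := ⟨x, mem_sphere_zero_iff_norm.2 hx⟩
    change ((G.invA (G.foldInv (z : 𝔼 (n + 1))) : 𝔻 (n + 1)) : 𝔼 (n + 1)) = (z : 𝔼 (n + 1))
    rw [G.foldInv_coe_sphere, G.invA_jA]
  · intro x _
    exact mem_closedBall_zero_iff.1 (G.invA (G.foldInv x)).2
  · intro x hx h1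
    exact G.norm_invA_foldInv_lt_one (hsub hx).2 h1
  · intro x hx _
    have hxs := (hsub hx).2
    have hx1 : ‖x‖ ≤ 1 := (mem_closedShell_iff.1 hx).2
    have hA : G.foldInv x ∈ range G.jA := G.foldInv_mem_range_jA hxs hx1
    change G.fold (G.jA (closedBallRetraction (n + 1)
      ((G.invA (G.foldInv x) : 𝔻 (n + 1)) : 𝔼 (n + 1)))) = x
    have : closedBallRetraction (n + 1) ((G.invA (G.foldInv x) : 𝔻 (n + 1)) : 𝔼 (n + 1)) =
        G.invA (G.foldInv x) :=
      Subtype.ext (closedBallRetraction_of_norm_le (n + 1)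
        (mem_closedBall_zero_iff.1 (G.invA (G.foldInv x)).2))
    rw [this, G.jA_invA hA, G.fold_foldInv hxs]

/-- **The bicollar induces an inner collar of `∂𝔻` in the second disc** (through the twist).
[folklore] -/
theorem exists_isInnerCollar_collarB :
    ∃ ε : ℝ, ε ≤ G.foldRadius ∧ IsInnerCollar ε G.collarB G.collarBInv := by
  obtain ⟨ε₁, hε₁, hw⟩ := G.exists_width_jB
  refine ⟨min ε₁ G.foldRadius, min_le_right _ _, ?_⟩
  have hsub := G.closedShell_subset (min_le_right ε₁ G.foldRadius)
  refine { pos := lt_min hε₁ G.foldRadius_pos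
           contDiffOn := G.contDiffOn_collarB.mono hsub
           contDiffOn_symm := ?_
           eq_self := ?_
           norm_le_one := ?_
           norm_lt_one := ?_
           left_inv := ?_ }
  · intro x hx
    have hx' := mem_closedShell_iff.1 hx
    set b : 𝔻 (n + 1) := closedBallRetraction (n + 1) x with hb
    have hbx : (b : 𝔼 (n + 1)) = x := closedBallRetraction_of_norm_le (n + 1) hx'.2
    have hbN : G.jB b ∈ G.foldNbhd := hw b (by
      rw [hbx]; exact lt_of_le_of_lt (by linarith [min_le_left ε₁ G.foldRadius]) hx'.1)
    have hg : ContMDiffAt (𝓡∂ (n + 1)) 𝓘(ℝ, 𝔼 (n + 1)) ∞ (fun y : 𝔻 (n + 1) => G.fold (G.jB y)) b :=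
      (G.contMDiffAt_fold_of_mem hbN).comp b G.contMDiff_jB.contMDiffAt
    have h := contDiffWithinAt_comp_closedBallRetraction hg
    rw [hbx] at h
    -- `untwist` is smooth at `fold (jB b)` (a vector of norm `≥ 1`)
    have hne : G.fold (G.jB b) ≠ 0 := by
      have := (G.one_le_norm_fold_iff hbN).2 ⟨b, rfl⟩
      intro h0; rw [h0, norm_zero] at this; linarith
    have h2 : ContDiffWithinAt ℝ ∞ G.collarBInv (closedBall (0 : 𝔼 (n + 1)) 1) x :=
      (contDiffAt_untwistVec (φ := φ) hne).comp_contDiffWithinAt x h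
    exact h2.mono closedShell_subset_closedBall
  · intro y hy
    set w : 𝕊 n := ⟨y, mem_sphere_zero_iff_norm.2 hy⟩
    change ((G.invB (G.foldInv (twistVec φ (w : 𝔼 (n + 1)))) : 𝔻 (n + 1)) : 𝔼 (n + 1)) =
      (w : 𝔼 (n + 1))
    rw [twistVec_coe_sphere, G.foldInv_coe_sphere, ← G.jB_sphereToBall, G.invB_jB]
  · intro y _
    exact mem_closedBall_zero_iff.1 (G.invB (G.foldInv (twistVec φ y))).2
  · intro y hy h1
    have hys := (hsub hy).2
    have ht := G.twistVec_mem h1.le hys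
    refine G.norm_invB_foldInv_lt_one ht.2 ?_
    rw [norm_twistVec (by linarith : ‖y‖ ≤ 2)]
    linarith
  · intro y hy _
    have hys := (hsub hy).2
    have hy1 : ‖y‖ ≤ 1 := (mem_closedShell_iff.1 hy).2
    have hy0 : y ≠ 0 := ne_zero_of_mem_biShell G.foldRadius_le_one hys
    have ht := G.twistVec_mem hy1 hys
    have hB : G.foldInv (twistVec φ y) ∈ range G.jB := G.foldInv_mem_range_jB ht.2 ht.1
    change untwistVec φ (G.fold (G.jB (closedBallRetraction (n + 1)
      ((G.invB (G.foldInv (twistVec φ y)) : 𝔻 (n + 1)) : 𝔼 (n + 1))))) = y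
    have : closedBallRetraction (n + 1)
        ((G.invB (G.foldInv (twistVec φ y)) : 𝔻 (n + 1)) : 𝔼 (n + 1)) =
        G.invB (G.foldInv (twistVec φ y)) :=
      Subtype.ext (closedBallRetraction_of_norm_le (n + 1)
        (mem_closedBall_zero_iff.1 (G.invB (G.foldInv (twistVec φ y))).2))
    rw [this, G.jB_invB hB, G.fold_foldInv ht.2, untwistVec_twistVec (by linarith)]

/-- On the inner half shell, `collarA x = jA⁻¹ (foldInv x)` with `jA (collarA x) = foldInv x`.
[folklore] -/
theorem jA_invA_foldInv {x : 𝔼 (n + 1)} (hx : x ∈ (biShell G.foldRadius : Set (𝔼 (n + 1))))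
    (h1 : ‖x‖ ≤ 1) : G.jA (G.invA (G.foldInv x)) = G.foldInv x :=
  G.jA_invA (G.foldInv_mem_range_jA hx h1)

/-- On the outer half shell, `jB (jB⁻¹ (foldInv x)) = foldInv x`. [folklore] -/
theorem jB_invB_foldInv {x : 𝔼 (n + 1)} (hx : x ∈ (biShell G.foldRadius : Set (𝔼 (n + 1))))
    (h1 : 1 ≤ ‖x‖) : G.jB (G.invB (G.foldInv x)) = G.foldInv x :=
  G.jB_invB (G.foldInv_mem_range_jB hx h1)

omit [IsManifold (𝓡 (n + 1)) ∞ P] [T2Space P] in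
/-- **Trichotomy of points of the glued manifold**: interior of the first disc, interior of the
second disc, or seam. [folklore] -/
theorem point_cases {C : P → Prop} (hA : ∀ a : 𝔻 (n + 1), ‖(a : 𝔼 (n + 1))‖ < 1 → C (G.jA a))
    (hB : ∀ b : 𝔻 (n + 1), ‖(b : 𝔼 (n + 1))‖ < 1 → C (G.jB b))
    (hS : ∀ z : 𝕊 n, C (G.jA (sphereToBall n z))) (p : P) : C p := by
  rcases G.mem_range_or p with ⟨a, rfl⟩ | ⟨b, rfl⟩
  · by_cases ha : ‖(a : 𝔼 (n + 1))‖ < 1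
    · exact hA a ha
    · obtain ⟨z, rfl⟩ :=
        exists_sphereToBall_eq ((mem_closedBall_zero_iff.1 a.2).antisymm (not_lt.1 ha))
      exact hS z
  · by_cases hb : ‖(b : 𝔼 (n + 1))‖ < 1
    · exact hB b hb
    · obtain ⟨w, rfl⟩ :=
        exists_sphereToBall_eq ((mem_closedBall_zero_iff.1 b.2).antisymm (not_lt.1 hb))
      rw [G.jB_sphereToBall]
      exact hS _

end BallGluingData

end Collars

/-! ### Conjugating data and the glued diffeomorphism -/

section Glue

variable {n : ℕ} {φ : (𝕊 n) ≃ₘ⟮𝓡 n, 𝓡 n⟯ (𝕊 n)}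
  {P : Type*} [TopologicalSpace P] [ChartedSpace (𝔼 (n + 1)) P] [IsManifold (𝓡 (n + 1)) ∞ P]
  [T2Space P]
  {P' : Type*} [TopologicalSpace P'] [ChartedSpace (𝔼 (n + 1)) P'] [IsManifold (𝓡 (n + 1)) ∞ P']
  [T2Space P']

namespace BallGluingData

/-- **Conjugating data** between two gluings `G`, `G'` of two discs along the same `φ`:
diffeomorphisms `GA`, `GB` of the open unit ball conjugating, on a thin shell `{1 - δ ≤ ‖·‖ < 1}`,
the inner collars induced by the two bicollars: `GA ∘ G.collarA = G'.collarA`,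
`GB ∘ G.collarB = G'.collarB`. Existence: `nonempty_conjData` (uniqueness of collars of `∂𝔻`,
`CollarUniquenessBall.lean`). [folklore] -/
structure ConjData (G : BallGluingData n φ P) (G' : BallGluingData n φ P') where
  /-- The diffeomorphism of the open ball for the first discs. -/
  GA : OpenPartialHomeomorph (𝔼 (n + 1)) (𝔼 (n + 1))
  /-- The diffeomorphism of the open ball for the second discs. -/
  GB : OpenPartialHomeomorph (𝔼 (n + 1)) (𝔼 (n + 1))
  /-- The width of the shell on which the conjugations hold. -/
  δ : ℝ
  δ_pos : 0 < δ
  δ_lt : δ < G.foldRadius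
  δ_lt' : δ < G'.foldRadius
  GA_source : GA.source = ball 0 1
  GA_target : GA.target = ball 0 1
  GB_source : GB.source = ball 0 1
  GB_target : GB.target = ball 0 1
  contDiffOn_GA : ContDiffOn ℝ ∞ GA (ball 0 1)
  contDiffOn_GA_symm : ContDiffOn ℝ ∞ GA.symm (ball 0 1)
  contDiffOn_GB : ContDiffOn ℝ ∞ GB (ball 0 1)
  contDiffOn_GB_symm : ContDiffOn ℝ ∞ GB.symm (ball 0 1)
  conjA : ∀ x : 𝔼 (n + 1), 1 - δ ≤ ‖x‖ → ‖x‖ < 1 → GA (G.collarA x) = G'.collarA x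
  conjB : ∀ y : 𝔼 (n + 1), 1 - δ ≤ ‖y‖ → ‖y‖ < 1 → GB (G.collarB y) = G'.collarB y

variable (G : BallGluingData n φ P) (G' : BallGluingData n φ P')

/-- **Existence of conjugating data** (uniqueness of collars of `∂𝔻`, twice). [folklore] -/
theorem nonempty_conjData : Nonempty (ConjData G G') := by
  obtain ⟨εA, hεA, hA⟩ := G.exists_isInnerCollar_collarA
  obtain ⟨εA', hεA', hA'⟩ := G'.exists_isInnerCollar_collarA
  obtain ⟨εB, hεB, hB⟩ := G.exists_isInnerCollar_collarB
  obtain ⟨εB', hεB', hB'⟩ := G'.exists_isInnerCollar_collarB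
  set ε₀ := min (min εA εA') (min εB εB') with hε₀
  have h0 : 0 < ε₀ := lt_min (lt_min hA.pos hA'.pos) (lt_min hB.pos hB'.pos)
  have h1 : ε₀ ≤ εA := (min_le_left _ _).trans (min_le_left _ _)
  have h2 : ε₀ ≤ εA' := (min_le_left _ _).trans (min_le_right _ _)
  have h3 : ε₀ ≤ εB := (min_le_right _ _).trans (min_le_left _ _)
  have h4 : ε₀ ≤ εB' := (min_le_right _ _).trans (min_le_right _ _)
  obtain ⟨GA, δA, hδA, hδAε, hsA, htA, hcA, hcA', hconjA⟩ :=
    (hA.mono h0 h1).exists_openPartialHomeomorph_conj (hA'.mono h0 h2)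
  obtain ⟨GB, δB, hδB, hδBε, hsB, htB, hcB, hcB', hconjB⟩ :=
    (hB.mono h0 h3).exists_openPartialHomeomorph_conj (hB'.mono h0 h4)
  refine ⟨{ GA := GA, GB := GB, δ := min δA δB, δ_pos := lt_min hδA hδB
            δ_lt := ?_, δ_lt' := ?_
            GA_source := hsA, GA_target := htA, GB_source := hsB, GB_target := htB
            contDiffOn_GA := hcA, contDiffOn_GA_symm := hcA'
            contDiffOn_GB := hcB, contDiffOn_GB_symm := hcB'
            conjA := fun x hx hx1 => hconjA x ((sub_le_sub_left (min_le_left _ _) _).trans hx) hx1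
            conjB := fun y hy hy1 =>
              hconjB y ((sub_le_sub_left (min_le_right _ _) _).trans hy) hy1 }⟩
  · exact ((min_le_left _ _).trans_lt hδAε).trans_le (h1.trans hεA)
  · exact ((min_le_left _ _).trans_lt hδAε).trans_le (h2.trans hεA')

namespace ConjData

variable {G G'} (D : ConjData G G')

/-- `GA` maps the open ball into itself. [folklore] -/
theorem norm_GA_lt_one {a : 𝔼 (n + 1)} (ha : ‖a‖ < 1) : ‖D.GA a‖ < 1 := by
  have := D.GA.map_source (x := a) (by rw [D.GA_source]; exact mem_ball_zero_iff.2 ha)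
  rw [D.GA_target] at this
  exact mem_ball_zero_iff.1 this

/-- `GB` maps the open ball into itself. [folklore] -/
theorem norm_GB_lt_one {b : 𝔼 (n + 1)} (hb : ‖b‖ < 1) : ‖D.GB b‖ < 1 := by
  have := D.GB.map_source (x := b) (by rw [D.GB_source]; exact mem_ball_zero_iff.2 hb)
  rw [D.GB_target] at this
  exact mem_ball_zero_iff.1 this

/-- `GA⁻¹` maps the open ball into itself. [folklore] -/
theorem norm_GA_symm_lt_one {a : 𝔼 (n + 1)} (ha : ‖a‖ < 1) : ‖D.GA.symm a‖ < 1 := by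
  have := D.GA.map_target (x := a) (by rw [D.GA_target]; exact mem_ball_zero_iff.2 ha)
  rw [D.GA_source] at this
  exact mem_ball_zero_iff.1 this

/-- `GB⁻¹` maps the open ball into itself. [folklore] -/
theorem norm_GB_symm_lt_one {b : 𝔼 (n + 1)} (hb : ‖b‖ < 1) : ‖D.GB.symm b‖ < 1 := by
  have := D.GB.map_target (x := b) (by rw [D.GB_target]; exact mem_ball_zero_iff.2 hb)
  rw [D.GB_source] at this
  exact mem_ball_zero_iff.1 this

/-- **Inverting conjugating data.** [folklore] -/
def symm : ConjData G' G where
  GA := D.GA.symm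
  GB := D.GB.symm
  δ := D.δ
  δ_pos := D.δ_pos
  δ_lt := D.δ_lt'
  δ_lt' := D.δ_lt
  GA_source := by rw [OpenPartialHomeomorph.symm_source, D.GA_target]
  GA_target := by rw [OpenPartialHomeomorph.symm_target, D.GA_source]
  GB_source := by rw [OpenPartialHomeomorph.symm_source, D.GB_target]
  GB_target := by rw [OpenPartialHomeomorph.symm_target, D.GB_source]
  contDiffOn_GA := D.contDiffOn_GA_symm
  contDiffOn_GA_symm := by rw [OpenPartialHomeomorph.symm_symm]; exact D.contDiffOn_GA
  contDiffOn_GB := D.contDiffOn_GB_symm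
  contDiffOn_GB_symm := by rw [OpenPartialHomeomorph.symm_symm]; exact D.contDiffOn_GB
  conjA x hx hx1 := by
    have hsrc : G.collarA x ∈ D.GA.source := by
      rw [D.GA_source, mem_ball_zero_iff]
      have hxs : x ∈ (biShell G.foldRadius : Set (𝔼 (n + 1))) :=
        ⟨by linarith [D.δ_lt], by linarith [G.foldRadius_pos]⟩
      exact G.norm_invA_foldInv_lt_one hxs hx1
    rw [← D.conjA x hx hx1, D.GA.left_inv hsrc]
  conjB y hy hy1 := by
    have hsrc : G.collarB y ∈ D.GB.source := by
      rw [D.GB_source, mem_ball_zero_iff]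
      have hys : y ∈ (biShell G.foldRadius : Set (𝔼 (n + 1))) :=
        ⟨by linarith [D.δ_lt], by linarith [G.foldRadius_pos]⟩
      have ht := G.twistVec_mem hy1.le hys
      refine G.norm_invB_foldInv_lt_one ht.2 ?_
      rw [norm_twistVec (by linarith : ‖y‖ ≤ 2)]
      linarith
    rw [← D.conjB y hy hy1, D.GB.left_inv hsrc]

/-- Unfolding `symm.GA`. [folklore] -/
@[simp] theorem symm_GA : D.symm.GA = D.GA.symm := rfl

/-- Unfolding `symm.GB`. [folklore] -/
@[simp] theorem symm_GB : D.symm.GB = D.GB.symm := rfl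

/-- Unfolding `symm.δ`. [folklore] -/
@[simp] theorem symm_δ : D.symm.δ = D.δ := rfl

open scoped Classical in
/-- **The glued map `P → P'`**: `jA a ↦ jA' (GA a)` on the interior of the first disc,
`jB b ↦ jB' (GB b)` on the interior of the second disc, `fold'⁻¹ ∘ fold` on the seam. [folklore] -/
def glue (p : P) : P' :=
  if p ∈ G.jA '' {a : 𝔻 (n + 1) | ‖(a : 𝔼 (n + 1))‖ < 1} then
    G'.jA (closedBallRetraction (n + 1) (D.GA ((G.invA p : 𝔻 (n + 1)) : 𝔼 (n + 1))))
  else if p ∈ G.jB '' {b : 𝔻 (n + 1) | ‖(b : 𝔼 (n + 1))‖ < 1} then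
    G'.jB (closedBallRetraction (n + 1) (D.GB ((G.invB p : 𝔻 (n + 1)) : 𝔼 (n + 1))))
  else G'.foldInv (G.fold p)

/-- The glued map on the interior of the first disc. [folklore] -/
theorem glue_jA {a : 𝔻 (n + 1)} (ha : ‖(a : 𝔼 (n + 1))‖ < 1) :
    D.glue (G.jA a) = G'.jA (closedBallRetraction (n + 1) (D.GA a)) := by
  rw [glue, if_pos ⟨a, ha, rfl⟩, G.invA_jA]

/-- The glued map on the interior of the second disc. [folklore] -/
theorem glue_jB {b : 𝔻 (n + 1)} (hb : ‖(b : 𝔼 (n + 1))‖ < 1) :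
    D.glue (G.jB b) = G'.jB (closedBallRetraction (n + 1) (D.GB b)) := by
  have h1 : G.jB b ∉ G.jA '' {a : 𝔻 (n + 1) | ‖(a : 𝔼 (n + 1))‖ < 1} := by
    rintro ⟨a, -, ha⟩
    exact G.jB_notMem_range_jA hb ⟨a, ha⟩
  rw [glue, if_neg h1, if_pos ⟨b, hb, rfl⟩, G.invB_jB]

/-- The glued map on the seam. [folklore] -/
theorem glue_of_mem_seam {p : P} (hp : p ∈ G.seam) : D.glue p = G'.foldInv (G.fold p) := by
  obtain ⟨z, rfl⟩ := hp
  have h1 : G.jA (sphereToBall n z) ∉ G.jA '' {a : 𝔻 (n + 1) | ‖(a : 𝔼 (n + 1))‖ < 1} := by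
    rintro ⟨a, ha, ha'⟩
    rw [G.injective_jA ha'] at ha
    simp at ha
  have h2 : G.jA (sphereToBall n z) ∉ G.jB '' {b : 𝔻 (n + 1) | ‖(b : 𝔼 (n + 1))‖ < 1} := by
    rintro ⟨b, hb, hb'⟩
    exact G.jB_notMem_range_jA hb ⟨_, hb'.symm⟩
  rw [glue, if_neg h1, if_neg h2]

/-- The glued map sends the seam point `jA z` to the seam point `jA' z`. [folklore] -/
theorem glue_jA_sphereToBall (z : 𝕊 n) :
    D.glue (G.jA (sphereToBall n z)) = G'.jA (sphereToBall n z) := by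
  rw [D.glue_of_mem_seam (G.jA_sphereToBall_mem_seam z), G.fold_jA_sphereToBall,
    G'.foldInv_coe_sphere]

/-- **The three formulas agree near the seam**: on the part of the bicollar over the shell of
width `δ`, the glued map is `fold'⁻¹ ∘ fold`. [folklore] -/
theorem glue_eq_foldInv_fold {p : P} (hp : p ∈ G.foldNbhd)
    (hδ : G.fold p ∈ (biShell D.δ : Set (𝔼 (n + 1)))) : D.glue p = G'.foldInv (G.fold p) := by
  set x := G.fold p with hx_def
  have hx : x ∈ (biShell G.foldRadius : Set (𝔼 (n + 1))) := G.fold_mem_biShell hp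
  have hx' : x ∈ (biShell G'.foldRadius : Set (𝔼 (n + 1))) := biShell_mono D.δ_lt'.le hδ
  have hpx : G.foldInv x = p := G.foldInv_fold hp
  refine G.point_cases (C := fun q => q = p → D.glue q = G'.foldInv (G.fold q)) ?_ ?_ ?_ p rfl
  · rintro a ha rfl
    have h1 : ‖x‖ < 1 := (G.norm_fold_lt_one_iff hp).2 ⟨a, ha, rfl⟩
    have hcol : G.collarA x = a := by
      change ((G.invA (G.foldInv x) : 𝔻 (n + 1)) : 𝔼 (n + 1)) = a
      rw [hpx, G.invA_jA]
    have hconj := D.conjA x hδ.1.le h1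
    rw [hcol] at hconj
    rw [D.glue_jA ha, hconj]
    change G'.jA (closedBallRetraction (n + 1)
      ((G'.invA (G'.foldInv x) : 𝔻 (n + 1)) : 𝔼 (n + 1))) = G'.foldInv x
    have : closedBallRetraction (n + 1) ((G'.invA (G'.foldInv x) : 𝔻 (n + 1)) : 𝔼 (n + 1)) =
        G'.invA (G'.foldInv x) :=
      Subtype.ext (closedBallRetraction_of_norm_le (n + 1)
        (mem_closedBall_zero_iff.1 (G'.invA (G'.foldInv x)).2))
    rw [this, G'.jA_invA_foldInv hx' h1.le]
  · rintro b hb rfl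
    have h1 : 1 < ‖x‖ := (G.one_lt_norm_fold_iff hp).2 ⟨b, hb, rfl⟩
    have hx0 : x ≠ 0 := by intro h0; rw [h0, norm_zero] at h1; linarith
    have hx2 : ‖x‖ < 2 := by linarith [hx.2, G.foldRadius_le_one]
    set y := untwistVec φ x with hy_def
    have hyn : ‖y‖ = 2 - ‖x‖ := norm_untwistVec hx2.le
    have hty : twistVec φ y = x := twistVec_untwistVec hx2
    have hcol : G.collarB y = b := by
      change ((G.invB (G.foldInv (twistVec φ y)) : 𝔻 (n + 1)) : 𝔼 (n + 1)) = b
      rw [hty, hpx, G.invB_jB]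
    have hconj := D.conjB y (by rw [hyn]; linarith [hδ.2]) (by rw [hyn]; linarith)
    rw [hcol] at hconj
    rw [D.glue_jB hb, hconj]
    change G'.jB (closedBallRetraction (n + 1)
      ((G'.invB (G'.foldInv (twistVec φ y)) : 𝔻 (n + 1)) : 𝔼 (n + 1))) = G'.foldInv x
    rw [hty]
    have : closedBallRetraction (n + 1) ((G'.invB (G'.foldInv x) : 𝔻 (n + 1)) : 𝔼 (n + 1)) =
        G'.invB (G'.foldInv x) :=
      Subtype.ext (closedBallRetraction_of_norm_le (n + 1)
        (mem_closedBall_zero_iff.1 (G'.invB (G'.foldInv x)).2))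
    rw [this, G'.jB_invB_foldInv hx' h1.le]
  · rintro z hz
    rw [D.glue_of_mem_seam (G.jA_sphereToBall_mem_seam z)]

/-- **The glued map is `C^∞`.** [folklore] -/
theorem contMDiff_glue : ContMDiff (𝓡 (n + 1)) (𝓡 (n + 1)) ∞ D.glue := by
  intro p
  refine G.point_cases (C := fun q => ContMDiffAt (𝓡 (n + 1)) (𝓡 (n + 1)) ∞ D.glue q) ?_ ?_ ?_ p
  · -- interior of the first disc
    intro a ha
    have hU := G.isOpen_image_jA_ball
    have hpU : G.jA a ∈ G.jA '' {a : 𝔻 (n + 1) | ‖(a : 𝔼 (n + 1))‖ < 1} := ⟨a, ha, rfl⟩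
    have h1 : ContMDiffAt (𝓡 (n + 1)) 𝓘(ℝ, 𝔼 (n + 1)) ∞
        (fun q => ((G.invA q : 𝔻 (n + 1)) : 𝔼 (n + 1))) (G.jA a) :=
      G.contMDiffAt_coe_invA hU (by rintro _ ⟨a', -, rfl⟩; exact ⟨a', rfl⟩) hpU
    have h2 : ContMDiffAt 𝓘(ℝ, 𝔼 (n + 1)) 𝓘(ℝ, 𝔼 (n + 1)) ∞ D.GA (a : 𝔼 (n + 1)) :=
      (D.contDiffOn_GA.contDiffAt (isOpen_ball.mem_nhds (mem_ball_zero_iff.2 ha))).contMDiffAt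
    have h3 : ContMDiffAt 𝓘(ℝ, 𝔼 (n + 1)) (𝓡∂ (n + 1)) ∞ (closedBallRetraction (n + 1))
        (D.GA (a : 𝔼 (n + 1))) := contMDiffAt_closedBallRetraction (D.norm_GA_lt_one ha)
    have h23 : ContMDiffAt 𝓘(ℝ, 𝔼 (n + 1)) (𝓡∂ (n + 1)) ∞
        (fun v => closedBallRetraction (n + 1) (D.GA v)) (a : 𝔼 (n + 1)) := h3.comp _ h2
    have h123 : ContMDiffAt (𝓡 (n + 1)) (𝓡∂ (n + 1)) ∞
        (fun q => closedBallRetraction (n + 1) (D.GA ((G.invA q : 𝔻 (n + 1)) : 𝔼 (n + 1))))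
        (G.jA a) := h23.comp_of_eq h1 (by simp)
    have h4 : ContMDiffAt (𝓡 (n + 1)) (𝓡 (n + 1)) ∞
        (fun q => G'.jA (closedBallRetraction (n + 1) (D.GA ((G.invA q : 𝔻 (n + 1)) : 𝔼 (n + 1)))))
        (G.jA a) := G'.contMDiff_jA.contMDiffAt.comp _ h123
    refine h4.congr_of_eventuallyEq ?_
    filter_upwards [hU.mem_nhds hpU]
    rintro _ ⟨a', ha', rfl⟩
    rw [D.glue_jA ha', G.invA_jA]
  · -- interior of the second disc
    intro b hb
    have hU := G.isOpen_image_jB_ball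
    have hpU : G.jB b ∈ G.jB '' {b : 𝔻 (n + 1) | ‖(b : 𝔼 (n + 1))‖ < 1} := ⟨b, hb, rfl⟩
    have h1 : ContMDiffAt (𝓡 (n + 1)) 𝓘(ℝ, 𝔼 (n + 1)) ∞
        (fun q => ((G.invB q : 𝔻 (n + 1)) : 𝔼 (n + 1))) (G.jB b) :=
      G.contMDiffAt_coe_invB hU (by rintro _ ⟨b', -, rfl⟩; exact ⟨b', rfl⟩) hpU
    have h2 : ContMDiffAt 𝓘(ℝ, 𝔼 (n + 1)) 𝓘(ℝ, 𝔼 (n + 1)) ∞ D.GB (b : 𝔼 (n + 1)) :=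
      (D.contDiffOn_GB.contDiffAt (isOpen_ball.mem_nhds (mem_ball_zero_iff.2 hb))).contMDiffAt
    have h3 : ContMDiffAt 𝓘(ℝ, 𝔼 (n + 1)) (𝓡∂ (n + 1)) ∞ (closedBallRetraction (n + 1))
        (D.GB (b : 𝔼 (n + 1))) := contMDiffAt_closedBallRetraction (D.norm_GB_lt_one hb)
    have h23 : ContMDiffAt 𝓘(ℝ, 𝔼 (n + 1)) (𝓡∂ (n + 1)) ∞
        (fun v => closedBallRetraction (n + 1) (D.GB v)) (b : 𝔼 (n + 1)) := h3.comp _ h2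
    have h123 : ContMDiffAt (𝓡 (n + 1)) (𝓡∂ (n + 1)) ∞
        (fun q => closedBallRetraction (n + 1) (D.GB ((G.invB q : 𝔻 (n + 1)) : 𝔼 (n + 1))))
        (G.jB b) := h23.comp_of_eq h1 (by simp)
    have h4 : ContMDiffAt (𝓡 (n + 1)) (𝓡 (n + 1)) ∞
        (fun q => G'.jB (closedBallRetraction (n + 1) (D.GB ((G.invB q : 𝔻 (n + 1)) : 𝔼 (n + 1)))))
        (G.jB b) := G'.contMDiff_jB.contMDiffAt.comp _ h123
    refine h4.congr_of_eventuallyEq ?_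
    filter_upwards [hU.mem_nhds hpU]
    rintro _ ⟨b', hb', rfl⟩
    rw [D.glue_jB hb', G.invB_jB]
  · -- seam
    intro z
    set U := G.foldNbhd ∩ G.fold ⁻¹' biShell D.δ with hU_def
    have hU : IsOpen U :=
      G.contMDiffOn_fold_foldNbhd.continuousOn.isOpen_inter_preimage G.isOpen_foldNbhd
        (isOpen_biShell _)
    have hpU : G.jA (sphereToBall n z) ∈ U :=
      ⟨G.jA_sphereToBall_mem_foldNbhd z, by
        rw [mem_preimage, G.fold_jA_sphereToBall]
        exact mem_biShell_of_norm_eq_one D.δ_pos (by simp)⟩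
    have h1 : ContMDiffOn (𝓡 (n + 1)) (𝓡 (n + 1)) ∞ (G'.foldInv ∘ G.fold) U :=
      G'.contMDiffOn_foldInv.comp (G.contMDiffOn_fold_foldNbhd.mono inter_subset_left)
        fun q hq => biShell_mono D.δ_lt'.le hq.2
    refine (h1.contMDiffAt (hU.mem_nhds hpU)).congr_of_eventuallyEq ?_
    filter_upwards [hU.mem_nhds hpU] with q hq
    exact D.glue_eq_foldInv_fold hq.1 hq.2

/-- **The glued map of the inverted data inverts the glued map.** [folklore] -/
theorem glue_symm_glue (p : P) : D.symm.glue (D.glue p) = p := by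
  refine G.point_cases (C := fun q => D.symm.glue (D.glue q) = q) ?_ ?_ ?_ p
  · intro a ha
    have h1 : ‖D.GA a‖ < 1 := D.norm_GA_lt_one ha
    have h2 : ((closedBallRetraction (n + 1) (D.GA a) : 𝔻 (n + 1)) : 𝔼 (n + 1)) = D.GA a :=
      closedBallRetraction_of_norm_le (n + 1) h1.le
    rw [D.glue_jA ha, D.symm.glue_jA (by rw [h2]; exact h1), h2, symm_GA,
      D.GA.left_inv (by rw [D.GA_source]; exact mem_ball_zero_iff.2 ha)]
    exact congrArg G.jA (Subtype.ext (closedBallRetraction_of_norm_le (n + 1) ha.le))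
  · intro b hb
    have h1 : ‖D.GB b‖ < 1 := D.norm_GB_lt_one hb
    have h2 : ((closedBallRetraction (n + 1) (D.GB b) : 𝔻 (n + 1)) : 𝔼 (n + 1)) = D.GB b :=
      closedBallRetraction_of_norm_le (n + 1) h1.le
    rw [D.glue_jB hb, D.symm.glue_jB (by rw [h2]; exact h1), h2, symm_GB,
      D.GB.left_inv (by rw [D.GB_source]; exact mem_ball_zero_iff.2 hb)]
    exact congrArg G.jB (Subtype.ext (closedBallRetraction_of_norm_le (n + 1) hb.le))
  · intro z
    rw [D.glue_jA_sphereToBall, D.symm.glue_jA_sphereToBall]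

/-- `symm.symm` has the same glued map. [folklore] -/
theorem glue_symm_symm : D.symm.symm.glue = D.glue := by
  cases D
  rfl

/-- **The diffeomorphism `P ≅ P'` of two gluings of two discs along the same `φ`.** [folklore] -/
def diffeomorph : P ≃ₘ⟮𝓡 (n + 1), 𝓡 (n + 1)⟯ P' where
  toFun := D.glue
  invFun := D.symm.glue
  left_inv := D.glue_symm_glue
  right_inv p' := by
    have := D.symm.glue_symm_glue p'
    rwa [glue_symm_symm] at this
  contMDiff_toFun := D.contMDiff_glue
  contMDiff_invFun := D.symm.contMDiff_glue

/-- The diffeomorphism is the glued map. [folklore] -/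
@[simp] theorem coe_diffeomorph : (D.diffeomorph : P → P') = D.glue := rfl

/-- The diffeomorphism maps the first disc of `P` onto the first disc of `P'` compatibly on the
seam: `jA z ↦ jA' z`. [folklore] -/
theorem diffeomorph_jA_sphereToBall (z : 𝕊 n) :
    D.diffeomorph (G.jA (sphereToBall n z)) = G'.jA (sphereToBall n z) :=
  D.glue_jA_sphereToBall z

end ConjData

/-- **Any two gluings of two discs along the same `φ` are diffeomorphic** (data form).
[cite: HirschDT1976, Ch. 8 Thm. 2.1] -/
theorem nonempty_diffeomorph (G : BallGluingData n φ P) (G' : BallGluingData n φ P') :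
    Nonempty (P ≃ₘ⟮𝓡 (n + 1), 𝓡 (n + 1)⟯ P') :=
  ⟨(Classical.choice (nonempty_conjData G G')).diffeomorph⟩

end BallGluingData

/-! ### Main results -/

/-- **Uniqueness of the twisted sphere `Σ(φ) = 𝔻ⁿ⁺¹ ∪_φ 𝔻ⁿ⁺¹` up to diffeomorphism** (Hirsch's
Theorem 8.2.1 for two discs): two Hausdorff smooth `(n+1)`-manifolds which are both the gluing
of two closed `(n+1)`-discs along the same diffeomorphism `φ` of `𝕊ⁿ` are diffeomorphic.
Hirsch, *Differential Topology* (1976), Ch. 8, Thm. 2.1 (with Thm. 1.9); here proved via the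
flow-free bicollar of the seam (`BallGluingFoldOut.lean`) and the elementary uniqueness of collars
of `∂𝔻` (`CollarUniquenessBall.lean`). [cite: HirschDT1976, Ch. 8 Thm. 2.1] -/
theorem nonempty_diffeomorph_of_isTwistedSphere [Fact (isSmoothEmbedding_sphereInclusion' n)]
    (h : IsTwistedSphere n φ P) (h' : IsTwistedSphere n φ P') :
    Nonempty (P ≃ₘ⟮𝓡 (n + 1), 𝓡 (n + 1)⟯ P') := by
  obtain ⟨G⟩ := h.nonempty_ballGluingData
  obtain ⟨G'⟩ := h'.nonempty_ballGluingData
  exact G.nonempty_diffeomorph G'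

end Glue

section Consequences

variable {n : ℕ}

/-- **Any two bundled twisted spheres `Σ(φ)` are diffeomorphic**, unconditionally (the tree's
`TwistedSphere.nonempty_diffeomorph` takes the gluing-uniqueness fact as a hypothesis).
[cite: HirschDT1976, Ch. 8 Thm. 2.1] -/
theorem TwistedSphere.nonempty_diffeomorph' [Fact (isSmoothEmbedding_sphereInclusion' n)]
    {φ : (𝕊 n) ≃ₘ⟮𝓡 n, 𝓡 n⟯ (𝕊 n)} (S T : TwistedSphere n φ) :
    Nonempty (S.carrier ≃ₘ⟮𝓡 (n + 1), 𝓡 (n + 1)⟯ T.carrier) :=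
  nonempty_diffeomorph_of_isTwistedSphere S.isTwistedSphere T.isTwistedSphere

/-- **The named fact `nonempty_diffeomorph_of_isBoundaryGluing` (`Gluing.lean`) holds for two
closed discs** `M = N = 𝔻ⁿ⁺¹` (boundary data `closedBallBoundaryData n`) and Hausdorff `P`, `P'`.
[cite: HirschDT1976, Ch. 8 Thm. 2.1] -/
theorem nonempty_diffeomorph_of_isBoundaryGluing_closedBall
    [Fact (isSmoothEmbedding_sphereInclusion' n)]
    {P P' : Type} [TopologicalSpace P] [ChartedSpace (𝔼 (n + 1)) P] [IsManifold (𝓡 (n + 1)) ∞ P]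
    [T2Space P] [TopologicalSpace P'] [ChartedSpace (𝔼 (n + 1)) P'] [IsManifold (𝓡 (n + 1)) ∞ P']
    [T2Space P'] :
    nonempty_diffeomorph_of_isBoundaryGluing (bM := closedBallBoundaryData n)
      (bN := closedBallBoundaryData n) (P := P) (P' := P') :=
  fun hP hP' => nonempty_diffeomorph_of_isTwistedSphere hP hP'

/-- **Twisted spheres along extendable diffeomorphisms are standard spheres**, unconditionally:
if `φ` extends over `𝔻ⁿ⁺¹` then every `T : TwistedSphere n φ` has `T.carrier ≅ 𝕊ⁿ⁺¹`.
Milnor (1965), §9; Kervaire–Milnor (1963), §1. [folklore] -/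
theorem TwistedSphere.nonempty_diffeomorph_sphere_of_extendsOverBall'' {n : ℕ}
    [Fact (isSmoothEmbedding_sphereInclusion' n)]
    {φ : (𝕊 n) ≃ₘ⟮𝓡 n, 𝓡 n⟯ (𝕊 n)} (T : TwistedSphere n φ) (hφ : ExtendsOverBall n φ) :
    Nonempty (T.carrier ≃ₘ⟮𝓡 (n + 1), 𝓡 (n + 1)⟯ (𝕊 (n + 1))) :=
  nonempty_diffeomorph_of_isTwistedSphere (T.isTwistedSphere.refl_of_extendsOverBall hφ)
    (isTwistedSphere_refl_sphere isDouble_sphere_holds)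

/-- **`cerf_twistedSphere_four` from Cerf's theorem in extension form, unconditionally in the
gluing facts**: if every self-diffeomorphism of `S³` extends over `D⁴`
(`cerf_diffeomorph_sphere_three_extends_ball`, Cerf 1968, Ch. I §1, Cor. 1), then every twisted
4-sphere is diffeomorphic to `S⁴`. The gluing hypotheses `hD`, `hU` of
`cerf_twistedSphere_four_of_extends` (`CerfGammaFourProofs.lean`) are now theorems.
[cite: Cerf1968, Summary by N. H. Kuiper (front matter), 1st par.] -/
theorem cerf_twistedSphere_four_of_extends'' (hC : cerf_diffeomorph_sphere_three_extends_ball) :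
    cerf_twistedSphere_four := by
  intro _ φ T
  exact T.nonempty_diffeomorph_sphere_of_extendsOverBall'' (hC φ)

/-- **Cerf's `Γ₄ = 0` in twisted-sphere form follows from Cerf's Théorème 1 alone.** If every
self-diffeomorphism of `S³` is diffeotopic to the identity or to a reflection
(`cerf_pi0Diff_sphere_three`, Cerf 1968, Ch. I §1, Théorème 1: `π₀ Diff(S³) = ℤ/2`), then every
twisted 4-sphere `D⁴ ∪_φ D⁴` is diffeomorphic to `S⁴` (`cerf_twistedSphere_four`,
`CerfGammaFour.lean`). The gluing-uniqueness hypothesis `hU` of `cerf_twistedSphere_four_of_pi0Diff`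
(`RadialExtension.lean`) is discharged by `nonempty_diffeomorph_of_isTwistedSphere`.
[cite: CerfDiffeoSphere1968, Ch. I §1, Théorème 1 with Corollaire 1 (Γ₄ = 0)] -/
theorem cerf_twistedSphere_four_of_pi0Diff' (h : cerf_pi0Diff_sphere_three) :
    cerf_twistedSphere_four :=
  cerf_twistedSphere_four_of_extends'' (cerf_diffeomorph_sphere_three_extends_ball_of_pi0Diff h)

end Consequences

end Literature.Topology.FourManifolds
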